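import Summits.QuantumFields.BalabanUV.Beta.EriceRemainderEnclosureHistoryAutonomyComparisonIsotoneExcess

/-!
# EriceRemainderEnclosureHistoryAutonomyComparisonAffine — (E57a) THE AFFINE MEMORY COMPARES AT ANY SIZE: for `B(u) = b + M·u_K` (floor `b > 0`, ONE
# affine memory term of age `K`, strength `M ≥ 0` of ANY size), every `B′ ≥ B` with a zeroth moment and an ISOTONE excess `B′ − B`, and ANY box
# solutions `h`, `h′` of `B`, `B′` from one pin `p ∈ ]0,γ]`: **`h′ ≤ h` at every scale** (`le_of_isotone_excess_affine`) — NO condition `M·γ ≤ 3√3·b`.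
# Key: THE ACCELERATION LEMMA `M·K·h(K)³ ≤ 2` along every box solution of `B` from every pin (§2 `accel`)

Cell `pub-balaban`, β-function sub-cell, BINDER row D4 «RemainderConst leaves for Bałaban's split» (`HOME/BINDER-OWNERS.md`; owner lineage `b2b-balaban-beta-an4`;
this file by co-owner #2 lineage `b2b-balaban-beta-d4-p2`, generation 50), β-FLOW TEAM duty (1), FREEZE (0) honoured (def-free: the functional is the displayed
lambda term `fun w ↦ b + M * w K`; (E49k)'s `family_le_of_orbit` ∕ `level_orbit_ge`, (E49j)'s `effective_le_of_small_pin` ∕ `excess_shift_le`, (E48a)'s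
`family_mem` ∕ `strictAnti_of_memFlow`, (E39)'s `exists_memFlow_zm`, (E43b)'s `memFlow_unique_of_monotone_zm`, node U2's `invSq_eq_of_memFlow` ∕ `drive` ∕
`Sharpness.abs_sub_le_half_cube_mul` BY NAME, nothing restated).  Companion of (E56a)∕(E56b) `…ComparisonIsotoneExcessSharp(End)` (for general ISOTONE memories
(E49k)'s class constant `3√3` is SHARP — hinge memories) and answer to the question left there and in `HOME/b2b-balaban-beta-d4-p2/g46/E50a-DOSSIER.md`
(«why do the probes with LINEAR memories `b + M·u_K`, `M·γ∕b` up to `3000`, never violate comparison?»): because for them comparison holds at ANY size.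

HONEST FRAMING (page 1, verbatim and binding).  *"Discharging BetaPertH makes Bałaban's UV stability UNCONDITIONAL — a real constructive-QFT result; it is
NOT the continuum limit and NOT the Clay problem."*  THIS FILE DISCHARGES NOTHING OF THE KIND.  Elementary real analysis about an ABSTRACT affine functional
on a box ]0,γ]^ℕ and abstract perturbations with displayed signs — hypotheses of a census, not facts; the form, signs and moments of Bałaban's (1.22) limit
functional are NOT PRINTED ([I] p. 298; GAPS G-t4-U2-1∕-2) and NOT asserted.  Row D4 class UNCHANGED (critical-path width 0; instance 0∕1; D4 DISCHARGE NO DATE).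
HONEST DEPENDENCY: continuum YM on T⁴ ⇐ BetaPertH ∧ nine spine estimates (0/9 proved); BetaPertH ⇐ (D1) ∧ (D4) ∧ CAP+tail; G-an2-4 gates asym, D1 and NE2/3/4.

THE POINT (census sense (α); the COMPARISON column).  (E49k) proves «isotone memory (zeroth moment `M`, floor `b`) + isotone excess ⟹ `h′ ≤ h`» under
`M·γ ≤ 3√3·b` by an induction down the levels whose STEP ((E49j) `effective_le_of_family_le_at`) bounds the memory drop `B h − B h′` under comparison by
`M·sup_j (c_j³∕2)·j·η ≤ (M·γ∕(3√3·b))·η` through the FLOOR ENVELOPE `c_j = (1∕y² + j·b)^{−1∕2}` — the only place the threshold enters; (E56b) shows the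
constant is sharp over all isotone memories (a hinge memory spends its moment once, exactly where `j·c_j³` peaks).  For the AFFINE memory the drop is
`M·(h_K − h′_K) ≤ (M·K·h_K³∕2)·η` with the TRUE coupling `h_K` of the trajectory, and §2 proves **`M·K·h_K³ ≤ 2` at ANY size**: the `K` memory terms read
before scale `K` are each `≥ M·h_{2K}` (`mul_mul_le_invSq`: `M·K·h_{2K} ≤ 1∕h_K²`), and the terms read between scales `K` and `2K` are termwise at most
those read before `K` (`invSq_two_mul_le`: `1∕h_{2K}² ≤ 2∕h_K²`, so `h_K ≤ 2·h_{2K}`) — a large memory ACCELERATES asymptotic freedom and kills its own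
leverage `h³`.  Hence the step holds with NO size condition (§3 `effective_le_of_family_le_at_affine`: drop `≤ η`), the base (small pins, `M·y ≤ (3√3∕2)·b`,
(E49j)(1)) is reached after finitely many floor steps from any level, and (E49k)'s induction runs verbatim (§4 `effective_le_all_affine`); existence ((E39))
and uniqueness ((E43b), isotone + zeroth moment, any size) make it family-free (`le_of_isotone_excess_affine`, `le_of_constant_excess_affine`).  THE PICTURE:
comparison in the functional with isotone excess costs `M·γ ≤ 3√3·b` for memories that can concentrate their moment (sharp), and NOTHING for the affine
memory of one age; the dossier's numerics (`g46/numerics/isotone_probe7.py`, `g50/e56/linear_probe.py`: no violation up to `M·γ∕b = 3000`, `K ≤ 21`; the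
acceleration quantity `(M∕2)·K·h_K³` peaks at `0.675 < 1` in `g50/e56/accel_check.py`) are explained.

WHAT IS PROVED ([folklore]; 0 `def`, 0 sorry).  §1 `floor_le_affine`, `affine_isotone`, `affine_zerothMoment`.  §2 **`mul_mul_le_invSq`**, **`invSq_two_mul_le`**,
**`accel`** (`M·K·h(K)³ ≤ 2`).  §3 **`effective_le_of_family_le_at_affine`**.  §4 **`effective_le_all_affine`**, **`le_of_isotone_excess_affine`**, `le_of_constant_excess_affine`.
-/
noncomputable section
open Finset Set

namespace Summit.QuantumFields.BalabanUV.Beta.EriceRemainderEnclosureHistoryAutonomyComparisonAffine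

open Literature.MathematicalPhysics.QuantumFieldTheory.Balaban1983to89
open Literature.MathematicalPhysics.QuantumFieldTheory.Balaban1983to89.T4BetaStationary
open Literature.MathematicalPhysics.QuantumFieldTheory.Balaban1983to89.T4BetaFlowWellPosed
open Literature.MathematicalPhysics.QuantumFieldTheory.Balaban1983to89.T4BetaFlowWellPosed.Sharpness (abs_sub_le_half_cube_mul)
open Summit.QuantumFields.BalabanUV.Beta.EriceRemainderEnclosureHistoryAutonomyThreshold (three_sqrt_three_pos)
open Summit.QuantumFields.BalabanUV.Beta.EriceRemainderEnclosureHistoryAutonomyOrder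
open Summit.QuantumFields.BalabanUV.Beta.EriceRemainderEnclosureHistoryAutonomyOrderMarkov
open Summit.QuantumFields.BalabanUV.Beta.EriceRemainderEnclosureHistoryAutonomyComparisonExcess
open Summit.QuantumFields.BalabanUV.Beta.EriceRemainderEnclosureHistoryAutonomyComparisonIsotoneExcess
open Summit.QuantumFields.BalabanUV.Beta.EriceRemainderEnclosureHistoryAutonomyExistence (exists_memFlow_zm)
open Summit.QuantumFields.BalabanUV.Beta.EriceRemainderEnclosureHistoryAutonomyMonotoneGeneral (memFlow_unique_of_monotone_zm)

variable {B' : (ℕ → ℝ) → ℝ} {M M' γ b y : ℝ} {K : ℕ} {h h' : ℕ → ℝ} {S S' : ℝ → ℕ → ℝ}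

/-! ## §1 The affine memory of age `K`: `B(u) = b + M·u_K` -/

/-- **THE AFFINE MEMORY `B(u) = b + M·u_K`** (floor `b`, ONE memory term of age `K`, strength `M ≥ 0`) has floor `b` on the box … [folklore] -/
theorem floor_le_affine (hM : 0 ≤ M) (u : ℕ → ℝ) (hu : SeqBox γ u) : b ≤ (fun w : ℕ → ℝ => b + M * w K) u := by
  simp only
  nlinarith [(hu K).1]

/-- … is ISOTONE in the history … [folklore] -/
theorem affine_isotone (hM : 0 ≤ M) : ∀ u v : ℕ → ℝ, SeqBox γ u → SeqBox γ v → (∀ j, u j ≤ v j) →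
    (fun w : ℕ → ℝ => b + M * w K) u ≤ (fun w : ℕ → ℝ => b + M * w K) v := by
  intro u v _ _ huv
  simp only
  nlinarith [huv K]

/-- … and has ZEROTH MOMENT `M`. [folklore] -/
theorem affine_zerothMoment (hM : 0 ≤ M) : ∀ u u' : ℕ → ℝ, SeqBox γ u → SeqBox γ u' → ∀ D : ℝ, (∀ j, |u j - u' j| ≤ D) →
    |(fun w : ℕ → ℝ => b + M * w K) u - (fun w : ℕ → ℝ => b + M * w K) u'| ≤ M * D := by
  intro u u' _ _ D hD
  simp only
  rw [show b + M * u K - (b + M * u' K) = M * (u K - u' K) by ring, abs_mul, abs_of_nonneg hM]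
  exact mul_le_mul_of_nonneg_left (hD K) hM

/-! ## §2 THE ACCELERATION LEMMA: along every box solution of the affine memory, `M·K·h(K)³ ≤ 2` — at ANY size `M` -/

/-- THE MEMORY PART OF THE DRIVE DOMINATES: for a box solution `h` of `B = b + M·u_K` from the pin `y`, the level at scale `K` satisfies
`M·K·h(2K) ≤ 1∕h(K)²` (each of the `K` memory terms read before scale `K` is at least `M·h(2K)`, `h` decreasing). [folklore] -/
theorem mul_mul_le_invSq (hM : 0 ≤ M) (hb : 0 < b) (hy : 0 < y) (hh : SeqBox γ h)
    (hf : MemFlow (fun w : ℕ → ℝ => b + M * w K) y h) : M * K * h (2 * K) ≤ 1 / h K ^ 2 := by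
  have hlo : ∀ u, SeqBox γ u → b ≤ (fun w : ℕ → ℝ => b + M * w K) u := fun u hu => floor_le_affine hM u hu
  have hanti := (strictAnti_of_memFlow hb hlo hh hf).antitone
  rw [invSq_eq_of_memFlow hf K]
  unfold drive
  have hterm : ∀ l ∈ range K, M * h (2 * K) ≤ (fun w : ℕ → ℝ => b + M * w K) (fun j => h (l + 1 + j)) := by
    intro l hl
    simp only
    have hl' : l < K := mem_range.mp hl
    have : h (l + 1 + K) ≥ h (2 * K) := hanti (by omega)
    nlinarith
  have hsum := sum_le_sum hterm
  rw [sum_const, card_range, nsmul_eq_mul] at hsum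
  have : 0 < 1 / y ^ 2 := by positivity
  linarith

/-- THE LEVELS AT MOST DOUBLE OVER THE NEXT `K` SCALES: `1∕h(2K)² ≤ 2∕h(K)²` (the memory terms read between scales `K` and `2K` are termwise at
most those read before scale `K`). [folklore] -/
theorem invSq_two_mul_le (hM : 0 ≤ M) (hb : 0 < b) (hy : 0 < y) (hh : SeqBox γ h)
    (hf : MemFlow (fun w : ℕ → ℝ => b + M * w K) y h) : 1 / h (2 * K) ^ 2 ≤ 2 * (1 / h K ^ 2) := by
  have hlo : ∀ u, SeqBox γ u → b ≤ (fun w : ℕ → ℝ => b + M * w K) u := fun u hu => floor_le_affine hM u hu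
  have hanti := (strictAnti_of_memFlow hb hlo hh hf).antitone
  rw [invSq_eq_of_memFlow hf (2 * K), invSq_eq_of_memFlow hf K]
  unfold drive
  rw [two_mul, sum_range_add]
  have hterm : ∀ l ∈ range K, (fun w : ℕ → ℝ => b + M * w K) (fun j => h (K + l + 1 + j)) ≤
      (fun w : ℕ → ℝ => b + M * w K) (fun j => h (l + 1 + j)) := by
    intro l _
    simp only
    have : h (K + l + 1 + K) ≤ h (l + 1 + K) := hanti (by omega)
    nlinarith
  have hsum := sum_le_sum hterm
  have : 0 < 1 / y ^ 2 := by positivity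
  linarith

/-- **THE ACCELERATION LEMMA**: `M·K·h(K)³ ≤ 2` along EVERY box solution of the affine memory from EVERY pin, WHATEVER `M ≥ 0` — a large memory
accelerates asymptotic freedom and kills its own leverage `h³` (contrast: through the floor envelope alone `M·K·c_K³` is bounded only by
`2M·y∕(3√3·b)`, (E38a)'s weight). [folklore] -/
theorem accel (hM : 0 ≤ M) (hb : 0 < b) (hy : 0 < y) (hh : SeqBox γ h)
    (hf : MemFlow (fun w : ℕ → ℝ => b + M * w K) y h) : M * K * h K ^ 3 ≤ 2 := by
  have h1 := mul_mul_le_invSq hM hb hy hh hf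
  have h2 := invSq_two_mul_le hM hb hy hh hf
  have hK := (hh K).1
  have h2K := (hh (2 * K)).1
  -- h K ≤ 2·h(2K): from 1/h(2K)² ≤ 2/h(K)² ≤ 4/h(K)²
  have h3 : h K ≤ 2 * h (2 * K) := by
    have e : h K ^ 2 ≤ 4 * h (2 * K) ^ 2 := by
      rw [div_le_iff₀ (by positivity)] at h2
      have : 2 * (1 / h K ^ 2) * h (2 * K) ^ 2 = 2 * h (2 * K) ^ 2 / h K ^ 2 := by ring
      rw [this, le_div_iff₀ (by positivity)] at h2
      nlinarith
    nlinarith [sq_nonneg (h K - 2 * h (2 * K)), sq_nonneg (h K + 2 * h (2 * K))]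
  -- M·K·h(2K)·h(K)² ≤ 1
  have h4 : M * K * h (2 * K) * h K ^ 2 ≤ 1 := by
    have := mul_le_mul_of_nonneg_right h1 (sq_nonneg (h K))
    rwa [one_div_mul_cancel (by positivity)] at this
  have hMK : 0 ≤ M * K := by positivity
  calc M * K * h K ^ 3 = (M * K * h K ^ 2) * h K := by ring
    _ ≤ (M * K * h K ^ 2) * (2 * h (2 * K)) := mul_le_mul_of_nonneg_left h3 (by positivity)
    _ = 2 * (M * K * h (2 * K) * h K ^ 2) := by ring
    _ ≤ 2 * 1 := by linarith
    _ = 2 := by ring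


/-! ## §3 THE ESTIMATE UNDER COMPARISON FROM THE PIN — with NO size condition -/

/-- **UNDER COMPARISON FROM THE PIN, THE EFFECTIVE β-FUNCTIONS ARE ORDERED AT THE PIN — AT ANY SIZE.**  `B = b + M·u_K` (`M ≥ 0`, `b > 0`),
`B ≤ B′` on the box with ISOTONE excess; `h`, `h′` box solutions of `B`, `B′` from one pin `y` with `h′ ≤ h` at every scale.  Then `B h ≤ B′ h′`: the
levels differ by at most `K·η` at scale `K` (`η = (B′ − B)(h′)` dominates the shifted excesses), so `M·(h_K − h′_K) ≤ (M·K·h_K³∕2)·η ≤ η` by the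
acceleration lemma — where (E49j) `effective_le_of_family_le_at` needed `M·y ≤ 3√3·b`. [folklore] -/
theorem effective_le_of_family_le_at_affine (hM : 0 ≤ M) (hb : 0 < b)
    (hexc : ∀ u, SeqBox γ u → (fun w : ℕ → ℝ => b + M * w K) u ≤ B' u)
    (hDmono : ∀ u v : ℕ → ℝ, SeqBox γ u → SeqBox γ v → (∀ j, u j ≤ v j) →
      B' u - (fun w : ℕ → ℝ => b + M * w K) u ≤ B' v - (fun w : ℕ → ℝ => b + M * w K) v)
    (hy : 0 < y) (hh : SeqBox γ h) (hf : MemFlow (fun w : ℕ → ℝ => b + M * w K) y h) (hh' : SeqBox γ h')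
    (hf' : MemFlow B' y h') (hle : ∀ j, h' j ≤ h j) : (fun w : ℕ → ℝ => b + M * w K) h ≤ B' h' := by
  have hlo : ∀ u, SeqBox γ u → b ≤ (fun w : ℕ → ℝ => b + M * w K) u := fun u hu => floor_le_affine hM u hu
  have hmono := affine_isotone (γ := γ) (b := b) (K := K) hM
  have hlo' : ∀ u, SeqBox γ u → b ≤ B' u := fun u hu => (hlo u hu).trans (hexc u hu)
  have hanti' : Antitone h' := (strictAnti_of_memFlow hb hlo' hh' hf').antitone
  set η : ℝ := B' h' - (fun w : ℕ → ℝ => b + M * w K) h' with hη_def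
  have hη0 : 0 ≤ η := by rw [hη_def]; linarith [hexc h' hh']
  have hηs : ∀ n, |(fun w : ℕ → ℝ => b + M * w K) (fun j => h' (n + 1 + j)) - B' (fun j => h' (n + 1 + j))| ≤ η :=
    excess_shift_le hexc hDmono hh' hanti'
  -- levels: 0 ≤ a′_K − a_K ≤ K·η
  have hlev : 1 / h' K ^ 2 - 1 / h K ^ 2 ≤ (K : ℝ) * η := by
    rw [invSq_eq_of_memFlow hf K, invSq_eq_of_memFlow hf' K, show (1:ℝ) / y ^ 2 + drive B' h' K -
      (1 / y ^ 2 + drive (fun w : ℕ → ℝ => b + M * w K) h K) = drive B' h' K - drive (fun w : ℕ → ℝ => b + M * w K) h K by ring]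
    unfold drive
    rw [← sum_sub_distrib]
    calc ∑ l ∈ range K, (B' (fun k => h' (l + 1 + k)) - (fun w : ℕ → ℝ => b + M * w K) (fun k => h (l + 1 + k)))
        ≤ ∑ _l ∈ range K, η := sum_le_sum fun l _ => by
          have e1 := (abs_le.mp (hηs l)).1
          have e2 := hmono _ _ (seqBox_shift hh' (l + 1)) (seqBox_shift hh (l + 1)) fun k => hle (l + 1 + k)
          linarith
      _ = (K : ℝ) * η := by rw [sum_const, card_range, nsmul_eq_mul]
  have hlev0 : 0 ≤ 1 / h' K ^ 2 - 1 / h K ^ 2 :=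
    sub_nonneg.mpr (one_div_le_one_div_of_le (pow_pos (hh' K).1 2) (pow_le_pow_left₀ (hh' K).1.le (hle K) 2))
  -- the gap at scale K: h_K − h′_K ≤ (h_K³/2)·K·η
  have hgap : |h K - h' K| ≤ h K ^ 3 / 2 * ((K : ℝ) * η) := by
    have hw := abs_sub_le_half_cube_mul (hh K).1 (hh' K).1 le_rfl (hle K)
    have habs : |1 / h K ^ 2 - 1 / h' K ^ 2| ≤ (K : ℝ) * η := by
      rw [abs_sub_comm, abs_of_nonneg hlev0]; exact hlev
    exact hw.trans (mul_le_mul_of_nonneg_left habs (by have := (hh K).1; positivity))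
  -- the memory drop M·(h_K − h′_K) ≤ (M·K·h_K³/2)·η ≤ η
  have hacc := accel hM hb hy hh hf
  have hdrop : M * (h K - h' K) ≤ η := by
    have h1 : h K - h' K ≤ h K ^ 3 / 2 * ((K : ℝ) * η) := (le_abs_self _).trans hgap
    calc M * (h K - h' K) ≤ M * (h K ^ 3 / 2 * ((K : ℝ) * η)) := mul_le_mul_of_nonneg_left h1 hM
      _ = (M * K * h K ^ 3) / 2 * η := by ring
      _ ≤ 2 / 2 * η := mul_le_mul_of_nonneg_right (div_le_div_of_nonneg_right hacc zero_le_two) hη0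
      _ = η := by ring
  have e : (fun w : ℕ → ℝ => b + M * w K) h - (fun w : ℕ → ℝ => b + M * w K) h' = M * (h K - h' K) := by simp only; ring
  rw [hη_def] at hdrop
  linarith [e]

/-! ## §4 THE INDUCTION DOWN THE LEVELS AND THE COMPARISON THEOREM — AT ANY SIZE -/

/-- **THE EFFECTIVE β-FUNCTIONS ARE ORDERED AT EVERY PIN, AT ANY SIZE.**  `B = b + M·u_K`, `B ≤ B′` with ISOTONE excess, `B′` with a zeroth moment;
solution families `S`, `S′` (unique).  Then `B (S y) ≤ B′ (S′ y)` for every `y ∈ ]0,γ]` — (E49k)'s induction `effective_le_all` verbatim (base: the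
small-pin estimate (E49j)(1) at levels `≥ 4M²∕(27b²)`; step: one floor step deeper along the orbit, comparison from the pin by `family_le_of_orbit`),
with §3 in place of (E49j)(2): NO threshold. [folklore] -/
theorem effective_le_all_affine {b' : ℝ} (hM : 0 ≤ M) (hγ : 0 < γ) (hb : 0 < b)
    (hexc : ∀ u, SeqBox γ u → (fun w : ℕ → ℝ => b + M * w K) u ≤ B' u)
    (hDmono : ∀ u v : ℕ → ℝ, SeqBox γ u → SeqBox γ v → (∀ j, u j ≤ v j) →
      B' u - (fun w : ℕ → ℝ => b + M * w K) u ≤ B' v - (fun w : ℕ → ℝ => b + M * w K) v)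
    (hb' : 0 < b') (hB' : ∀ u u' : ℕ → ℝ, SeqBox γ u → SeqBox γ u' → ∀ D : ℝ, (∀ j, |u j - u' j| ≤ D) → |B' u - B' u'| ≤ M' * D)
    (hM' : 0 ≤ M') (hlo' : ∀ u, SeqBox γ u → b' ≤ B' u)
    (hS : ∀ p, 0 < p → p ≤ γ → SeqBox γ (S p) ∧ MemFlow (fun w : ℕ → ℝ => b + M * w K) p (S p))
    (huniq : ∀ p, 0 < p → p ≤ γ → ∀ u u' : ℕ → ℝ, SeqBox γ u → SeqBox γ u' →
      MemFlow (fun w : ℕ → ℝ => b + M * w K) p u → MemFlow (fun w : ℕ → ℝ => b + M * w K) p u' → u = u')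
    (hS' : ∀ p, 0 < p → p ≤ γ → SeqBox γ (S' p) ∧ MemFlow B' p (S' p))
    (huniq' : ∀ p, 0 < p → p ≤ γ → ∀ u u' : ℕ → ℝ, SeqBox γ u → SeqBox γ u' → MemFlow B' p u → MemFlow B' p u' → u = u') :
    ∀ y, 0 < y → y ≤ γ → (fun w : ℕ → ℝ => b + M * w K) (S y) ≤ B' (S' y) := by
  have hB := affine_zerothMoment (γ := γ) (b := b) (K := K) hM
  have hlo : ∀ u, SeqBox γ u → b ≤ (fun w : ℕ → ℝ => b + M * w K) u := fun u hu => floor_le_affine hM u hu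
  have h33 : 0 < 3 * Real.sqrt 3 := three_sqrt_three_pos
  have hsq3 : Real.sqrt 3 ^ 2 = 3 := Real.sq_sqrt (by norm_num)
  -- the level threshold L = 4M²/(27 b²): 1/y² ≥ L ⟹ M·y ≤ (3√3/2)·b
  set L : ℝ := 4 * M ^ 2 / (27 * b ^ 2) with hL_def
  have hbase : ∀ y, 0 < y → y ≤ γ → L ≤ 1 / y ^ 2 → (fun w : ℕ → ℝ => b + M * w K) (S y) ≤ B' (S' y) := by
    intro y hy hyγ hlev
    have hMy : M * y ≤ 3 * Real.sqrt 3 / 2 * b := by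
      have hy2 : 0 < y ^ 2 := by positivity
      have k1 : 4 * M ^ 2 ≤ 1 / y ^ 2 * (27 * b ^ 2) := (div_le_iff₀ (by positivity : (0:ℝ) < 27 * b ^ 2)).mp hlev
      have k2 := mul_le_mul_of_nonneg_right k1 hy2.le
      have e : 1 / y ^ 2 * (27 * b ^ 2) * y ^ 2 = 27 * b ^ 2 := by field_simp
      rw [e] at k2
      have h1 : (2 * M * y) ^ 2 ≤ (3 * Real.sqrt 3 * b) ^ 2 := by nlinarith [hsq3, k2]
      have h2 : 2 * M * y ≤ 3 * Real.sqrt 3 * b := (sq_le_sq₀ (by positivity) (by positivity)).mp h1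
      linarith
    exact effective_le_of_small_pin hB hM hb hlo hexc hDmono hy hyγ hMy (hS y hy hyγ).1 (hS y hy hyγ).2 (hS' y hy hyγ).1 (hS' y hy hyγ).2
  -- induction on the number of floor steps below the threshold level
  have hind : ∀ n : ℕ, ∀ y, 0 < y → y ≤ γ → L - (n : ℝ) * b ≤ 1 / y ^ 2 → (fun w : ℕ → ℝ => b + M * w K) (S y) ≤ B' (S' y) := by
    intro n
    induction n with
    | zero => intro y hy hyγ hlev; exact hbase y hy hyγ (by simpa using hlev)
    | succ n ih =>
      intro y hy hyγ hlev
      have hy' : y ∈ Ioc (0 : ℝ) γ := ⟨hy, hyγ⟩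
      have hQ : ∀ j, 1 ≤ j → (fun w : ℕ → ℝ => b + M * w K) (S (S y j)) ≤ B' (S' (S y j)) := by
        intro j hj
        have hm := family_mem hS hy hyγ j
        refine ih (S y j) hm.1 hm.2 ?_
        have := level_orbit_ge hb hlo hS hy' hj
        rw [Nat.cast_succ] at hlev
        linarith
      have hcomp := family_le_of_orbit hb' hγ hB' hM' hlo' hS huniq hS' huniq' hy' hQ
      exact effective_le_of_family_le_at_affine hM hb hexc hDmono hy (hS y hy hyγ).1 (hS y hy hyγ).2 (hS' y hy hyγ).1
        (hS' y hy hyγ).2 hcomp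
  intro y hy hyγ
  obtain ⟨n, hn⟩ : ∃ n : ℕ, L / b ≤ n := exists_nat_ge (L / b)
  refine hind n y hy hyγ ?_
  have : L ≤ (n : ℝ) * b := by rw [div_le_iff₀ hb] at hn; linarith
  have : 0 ≤ 1 / y ^ 2 := by positivity
  linarith

/-- **THE AFFINE MEMORY COMPARES UNDER EVERY ISOTONE EXCESS, AT ANY SIZE** (family-free form).  `B(u) = b + M·u_K` on ]0,γ] (`b > 0`, `M ≥ 0` of ANY
size, any age `K`); `B′` with zeroth moment `M′ ≥ 0`, `B ≤ B′` on the box, and the EXCESS `B′ − B` ISOTONE; `h`, `h′` ANY box solutions of `B`, `B′` from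
one pin `p ∈ ]0,γ]`.  Then `h′ ≤ h` at EVERY scale — NO condition `M·γ ≤ 3√3·b`: the class constant `3√3` of (E49k), SHARP for general isotone memories
((E56b) `threshold_exact`, hinge memories), is an artefact for memories that spend their moment at every scale.  Explains the dossier's probes
(`b + M·u_K`, `M·γ∕b ≤ 3000`: no violation). [folklore] -/
theorem le_of_isotone_excess_affine {p : ℝ} (hM : 0 ≤ M) (hb : 0 < b)
    (hB' : ∀ u u' : ℕ → ℝ, SeqBox γ u → SeqBox γ u' → ∀ D : ℝ, (∀ j, |u j - u' j| ≤ D) → |B' u - B' u'| ≤ M' * D) (hM' : 0 ≤ M')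
    (hexc : ∀ u, SeqBox γ u → (fun w : ℕ → ℝ => b + M * w K) u ≤ B' u)
    (hDmono : ∀ u v : ℕ → ℝ, SeqBox γ u → SeqBox γ v → (∀ j, u j ≤ v j) →
      B' u - (fun w : ℕ → ℝ => b + M * w K) u ≤ B' v - (fun w : ℕ → ℝ => b + M * w K) v)
    (hp : 0 < p) (hpγ : p ≤ γ) (hh : SeqBox γ h) (hf : MemFlow (fun w : ℕ → ℝ => b + M * w K) p h) (hh' : SeqBox γ h')
    (hf' : MemFlow B' p h') (j : ℕ) : h' j ≤ h j := by
  have hγ : 0 < γ := hp.trans_le hpγ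
  have hB := affine_zerothMoment (γ := γ) (b := b) (K := K) hM
  have hmono := affine_isotone (γ := γ) (b := b) (K := K) hM
  have hlo : ∀ u, SeqBox γ u → b ≤ (fun w : ℕ → ℝ => b + M * w K) u := fun u hu => floor_le_affine hM u hu
  have hlo' : ∀ u, SeqBox γ u → b ≤ B' u := fun u hu => (hlo u hu).trans (hexc u hu)
  have hmono' : ∀ u v : ℕ → ℝ, SeqBox γ u → SeqBox γ v → (∀ j, u j ≤ v j) → B' u ≤ B' v := fun u v hu hv huv => by
    have := hDmono u v hu hv huv; have := hmono u v hu hv huv; simp only at *; linarith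
  -- the two solution families
  have hex : ∀ q : ℝ, 0 < q → q ≤ γ → ∃ k : ℕ → ℝ, SeqBox γ k ∧ MemFlow (fun w : ℕ → ℝ => b + M * w K) q k :=
    fun q hq hqγ => exists_memFlow_zm hB hM hq hqγ hb hlo
  have hex' : ∀ q : ℝ, 0 < q → q ≤ γ → ∃ k : ℕ → ℝ, SeqBox γ k ∧ MemFlow B' q k := fun q hq hqγ => exists_memFlow_zm hB' hM' hq hqγ hb hlo'
  choose! S hSb hSf using hex
  choose! S' hS'b hS'f using hex'
  have hS : ∀ q, 0 < q → q ≤ γ → SeqBox γ (S q) ∧ MemFlow (fun w : ℕ → ℝ => b + M * w K) q (S q) :=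
    fun q hq hqγ => ⟨hSb q hq hqγ, hSf q hq hqγ⟩
  have hS' : ∀ q, 0 < q → q ≤ γ → SeqBox γ (S' q) ∧ MemFlow B' q (S' q) := fun q hq hqγ => ⟨hS'b q hq hqγ, hS'f q hq hqγ⟩
  have huniq : ∀ q, 0 < q → q ≤ γ → ∀ u u' : ℕ → ℝ, SeqBox γ u → SeqBox γ u' →
      MemFlow (fun w : ℕ → ℝ => b + M * w K) q u → MemFlow (fun w : ℕ → ℝ => b + M * w K) q u' → u = u' :=
    fun q hq _ u u' hu hu' hfu hfu' => memFlow_unique_of_monotone_zm hmono hB hM hq hb hlo hu hu' hfu hfu'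
  have huniq' : ∀ q, 0 < q → q ≤ γ → ∀ u u' : ℕ → ℝ, SeqBox γ u → SeqBox γ u' → MemFlow B' q u → MemFlow B' q u' → u = u' :=
    fun q hq _ u u' hu hu' hfu hfu' => memFlow_unique_of_monotone_zm hmono' hB' hM' hq hb hlo' hu hu' hfu hfu'
  have e : h = S p := huniq p hp hpγ _ _ hh (hS p hp hpγ).1 hf (hS p hp hpγ).2
  have e' : h' = S' p := huniq' p hp hpγ _ _ hh' (hS' p hp hpγ).1 hf' (hS' p hp hpγ).2
  rw [e, e']
  exact family_le_of_orbit hb hγ hB' hM' hlo' hS huniq hS' huniq' ⟨hp, hpγ⟩ (fun i _ =>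
    effective_le_all_affine hM hγ hb hexc hDmono hb hB' hM' hlo' hS huniq hS' huniq' _
      (family_mem hS hp hpγ i).1 (family_mem hS hp hpγ i).2) j

/-- **IN PARTICULAR FOR A CONSTANT EXCESS**: the box solutions of `b + M·u_K` and `b + ε + M·u_K` (`ε ≥ 0`) from one pin satisfy `h′ ≤ h` at every scale,
for EVERY `M ≥ 0` — the translate that defeats the hinge memory beyond `M·γ = 3√3·b` ((E56a) `h_one_lt_h'_one`) never defeats the affine one. [folklore] -/
theorem le_of_constant_excess_affine {p ε : ℝ} (hM : 0 ≤ M) (hb : 0 < b) (hε : 0 ≤ ε) (hp : 0 < p) (hpγ : p ≤ γ)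
    (hh : SeqBox γ h) (hf : MemFlow (fun w : ℕ → ℝ => b + M * w K) p h) (hh' : SeqBox γ h')
    (hf' : MemFlow (fun w : ℕ → ℝ => b + ε + M * w K) p h') (j : ℕ) : h' j ≤ h j := by
  have hB'z := affine_zerothMoment (γ := γ) (b := b + ε) (K := K) hM
  exact le_of_isotone_excess_affine hM hb hB'z hM (fun u _ => by simp only; linarith)
    (fun u v _ _ _ => by simp only; linarith) hp hpγ hh hf hh' hf' j

end Summit.QuantumFields.BalabanUV.Beta.EriceRemainderEnclosureHistoryAutonomyComparisonAffine
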